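import Summits.ResolutionOfSingularities.ResolutionOfSingularities.Theorems.ValuativeLuAlphaPTorsorPthPowerModMonomialPresentation
import Literature.FieldTheory.Separability.PIndependentDerivations

/-!
# Every derivation of `R = k[X]_𝔮/ker` is, on finitely many elements, a combination of `ℤ`-derivations of `R`

Helper file for the stub `stub_pthPowerModMonomial` of the line `pfaff-line-log-final-forms`
(crux `Valuative.LuAlphaPTorsor`, item `stmt-ResolutionOfSingularities-0641`); setting as in
`ValuativeLuAlphaPTorsorPthPowerModMonomialPresentation.lean`: `S = k[X_1, …, X_n]`,
`Q = S_𝔮`, `Φq : Q ↠ R` onto a regular local ring, `Φ = Φq ∘ (S → Q)`; here `char k = p > 0`.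

* `exists_derivation_transport` — every `D ∈ Der(S)` yields `Δ ∈ Der_ℤ(R)` with
  `Δ(Φ F) = Φ(D F) - ∑_i Φ(D g_i) · Φq(D̃_i(F/1))` (extend `D` to `Q`, subtract
  `∑_i D(g_i/1) D̃_i` so that the generators `g_i/1` of `ker Φq` are killed, descend).
* `exists_derivations_sum_eq` — **richness of `Der_ℤ(R)`**: for a ring homomorphism
  `ψ : R → N` and a `ψ`-derivation `∂ : R → N` (additive, `∂(ab) = ψ(a)∂(b) + ψ(b)∂(a)`), and a
  finite set `Y ⊆ R`, there are finitely many `Δ_j ∈ Der_ℤ(R)` and `n_j ∈ N` with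
  `∂(y) = ∑_j ψ(Δ_j y) n_j` for all `y ∈ Y`. Proof: write the elements of `Y` as fractions of
  images of finitely many polynomials; their coefficients lie in `k^p(T)` for a finite `p`-free
  `T ⊆ k` with dual derivations `∂_t` (Matsumura §26; the tree's `exists_isPFree_subset`,
  `exists_dual_derivation`), so on these polynomials every derivation `𝔇` of `S` into a module
  expands as `𝔇(F) = ∑_l (∂F/∂X_l) 𝔇(X_l) + ∑_t (∂_t F) 𝔇(t)` (`derivation_apply_eq_sum_dual`,
  `MvPolynomial.derivation_apply_eq_of_eqOn`); transporting `∂/∂X_l`, `∂_t` to `R` the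
  correction terms cancel because `∂(Φ g_i) = ∂(0) = 0`, and fractions follow by the quotient
  rule.
-/

set_option linter.dupNamespace false

attribute [local instance 1100] Ring.toIntAlgebra AddCommGroup.toIntModule

namespace Summit.ResolutionOfSingularities.ResolutionOfSingularities.Theorems.PfaffLine

open IsLocalRing MvPolynomial Literature.AlgebraicGeometry.Resolution
  Literature.FieldTheory.Separability

universe u v

section Rich

variable (k : Type u) [Field k] (n : ℕ) {R : Type u} [CommRing R] [Algebra ℤ R]
  [IsRegularLocalRing R] (𝔮 : Ideal (MvPolynomial (Fin n) k)) [𝔮.IsPrime]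
  (Φq : Localization.AtPrime 𝔮 →+* R) (hsurj : Function.Surjective Φq)

include hsurj

omit [IsRegularLocalRing R] in
/-- **Transport of a derivation of `S` to `R`** along the Jacobian data: for `D ∈ Der(S)` there is
`Δ ∈ Der_ℤ(R)` with `Δ(Φ F) = Φ(D F) - ∑_i Φ(D g_i) Φq(D̃_i(F/1))`. [folklore] -/
theorem exists_derivation_transport {c d : ℕ} (g : Fin c → MvPolynomial (Fin n) k)
    (F : Fin d → MvPolynomial (Fin n) k)
    (Dt : Fin (c + d) → Derivation ℤ (Localization.AtPrime 𝔮) (Localization.AtPrime 𝔮))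
    (hspan : Ideal.span (Set.range fun i => algebraMap _ (Localization.AtPrime 𝔮) (g i)) =
      RingHom.ker Φq)
    (hDt : ∀ m m', Dt m (algebraMap _ _ (Fin.append g F m')) = if m = m' then 1 else 0)
    (D : Derivation ℤ (MvPolynomial (Fin n) k) (MvPolynomial (Fin n) k)) :
    ∃ Δ : Derivation ℤ R R, ∀ F' : MvPolynomial (Fin n) k,
      Δ (Φq (algebraMap _ _ F')) = Φq (algebraMap _ _ (D F')) -
        ∑ i : Fin c, Φq (algebraMap _ _ (D (g i))) *
          Φq (Dt (Fin.castAdd d i) (algebraMap _ _ F')) := by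
  classical
  obtain ⟨DQ, hDQ⟩ := exists_derivation_localization 𝔮 D
  set Δ₀ := DQ - ∑ i : Fin c, DQ (algebraMap _ _ (g i)) • Dt (Fin.castAdd d i) with hΔ₀
  have hΔ₀apply : ∀ z, Δ₀ z = DQ z - ∑ i : Fin c, DQ (algebraMap _ _ (g i)) * Dt (Fin.castAdd d i) z :=
    fun z => by
      rw [hΔ₀, Derivation.sub_apply, sum_derivation_apply]
      rfl
  have hkill : ∀ i', Δ₀ (algebraMap _ _ (g i')) = 0 := by
    intro i'
    rw [hΔ₀apply]
    have h1 : ∀ i : Fin c, Dt (Fin.castAdd d i) (algebraMap _ (Localization.AtPrime 𝔮) (g i')) =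
        if i = i' then 1 else 0 := fun i => by
      have h := hDt (Fin.castAdd d i) (Fin.castAdd d i')
      rw [Fin.append_left] at h
      rw [h]
      simp only [Fin.castAdd_inj]
    simp only [h1, mul_ite, mul_one, mul_zero, Finset.sum_ite_eq', Finset.mem_univ, if_true,
      sub_self]
  obtain ⟨Δ, hΔ⟩ := exists_derivation_descend k n 𝔮 Φq hsurj g hspan Δ₀ hkill
  refine ⟨Δ, fun F' => ?_⟩
  rw [hΔ, hΔ₀apply, map_sub, map_sum, hDQ]
  congr 1
  exact Finset.sum_congr rfl fun i _ => by rw [map_mul, hDQ]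

omit hsurj in
/-- **Expansion of a derivation of `S = k[X]` along `∂/∂X_l` and the dual derivations of a
`p`-free set of constants.** Let `T ⊆ k` be finite with dual derivations `∂_t` (`∂_t t' = δ`),
`∇X_l ∈ Der(S)` the partial derivatives (`∇X_l(c) = 0`, `∇X_l(X_m) = δ_lm`) and `∇T_t ∈ Der(S)`
the extensions of the `∂_t` killing the variables. Then every derivation `𝔇` of `S` into an
`S`-module satisfies `𝔇(F) = ∑_l ∇X_l(F) 𝔇(X_l) + ∑_{t ∈ T} ∇T_t(F) 𝔇(t)` for every `F` whose
coefficients lie in `k^p(T)`. (Matsumura, *Commutative Ring Theory*, §26 p. 202 and proof of Thm. 30.5.) [folklore] -/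
theorem derivation_apply_eq_sum_of_coeffs (p : ℕ) [Fact p.Prime] [CharP k p]
    (T : Finset k) (dT : k → Derivation ℤ k k)
    (hT : ∀ s ∈ T, dT s s = 1 ∧ ∀ t ∈ T, t ≠ s → dT s t = 0)
    (DX : Fin n → Derivation ℤ (MvPolynomial (Fin n) k) (MvPolynomial (Fin n) k))
    (hDXC : ∀ i c, DX i (C c) = 0) (hDXX : ∀ i l, DX i (X l) = if l = i then 1 else 0)
    (DT : k → Derivation ℤ (MvPolynomial (Fin n) k) (MvPolynomial (Fin n) k))
    (hDTC : ∀ s c, DT s (C c) = C (dT s c)) (hDTX : ∀ s l, DT s (X l) = 0)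
    {N : Type v} [AddCommGroup N] [Module (MvPolynomial (Fin n) k) N]
    (𝔇 : Derivation ℤ (MvPolynomial (Fin n) k) N) (F' : MvPolynomial (Fin n) k)
    (hF' : ∀ c ∈ F'.coeffs, c ∈ pAdjoin p (↑T : Set k)) :
    𝔇 F' = ∑ i, DX i F' • 𝔇 (X i) + ∑ s ∈ T, DT s F' • 𝔇 (C s) := by
  classical
  -- the right-hand side as a derivation
  set D₂ : Derivation ℤ (MvPolynomial (Fin n) k) N :=
    ∑ i, (LinearMap.toSpanSingleton _ N (𝔇 (X i))).compDer (DX i) +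
      ∑ s ∈ T, (LinearMap.toSpanSingleton _ N (𝔇 (C s))).compDer (DT s) with hD₂def
  have hD₂ : ∀ G, D₂ G = ∑ i, DX i G • 𝔇 (X i) + ∑ s ∈ T, DT s G • 𝔇 (C s) := fun G => by
    rw [hD₂def, Derivation.add_apply, sum_derivation_apply, sum_derivation_apply]
    rfl
  rw [← hD₂]
  refine MvPolynomial.derivation_apply_eq_of_eqOn 𝔇 D₂ F' (fun c hc => ?_) (fun l => ?_)
  · -- on coefficients: expand the derivation `c ↦ 𝔇 (C c)` of `k` along the `∂_t`
    change 𝔇 (C c) = D₂ (C c)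
    letI : Module k N := Module.compHom N (C : k →+* MvPolynomial (Fin n) k)
    let fk : k →+ N :=
      { toFun := fun c => 𝔇 (C c)
        map_zero' := by rw [C_0, map_zero]
        map_add' := fun a b => by rw [C_add, map_add] }
    have hfk : ∀ c, fk c = 𝔇 (C c) := fun c => rfl
    have hleib : ∀ a b, fk (a * b) = a • fk b + b • fk a := fun a b => by
      rw [hfk, hfk, hfk, C_mul, Derivation.leibniz]
      rfl
    obtain ⟨dk, hdk⟩ := exists_derivation_of_leibniz fk hleib
    have h := derivation_apply_eq_sum_dual hT dk (hF' c hc)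
    rw [hdk, hfk] at h
    rw [h, hD₂]
    simp only [hDXC, zero_smul, Finset.sum_const_zero, zero_add, hDTC, hdk]
    exact Finset.sum_congr rfl fun s _ => by rw [hfk]; rfl
  · change 𝔇 (X l) = D₂ (X l)
    rw [hD₂]
    simp only [hDXX, hDTX, zero_smul, Finset.sum_const_zero, add_zero, ite_smul, one_smul,
      Finset.sum_ite_eq, Finset.mem_univ, if_true]

/-- **Richness of `Der_ℤ(R)`.** For a ring homomorphism `ψ : R → N`, a `ψ`-derivation
`∂ : R → N` (additive with `∂(ab) = ψ(a)∂(b) + ψ(b)∂(a)`) and a finite `Y ⊆ R`, there are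
finitely many `ℤ`-derivations `Δ_j` of `R` and `n_j ∈ N` with `∂(y) = ∑_j ψ(Δ_j y) n_j` for all
`y ∈ Y` (see the module docstring). (Matsumura, *Commutative Ring Theory*, §26 p. 202 and proof of Thm. 30.5.) [folklore] -/
theorem exists_derivations_sum_eq (p : ℕ) [Fact p.Prime] [CharP k p]
    (N : Type u) [CommRing N] (ψ : R →+* N) (δ₀ : R →+ N)
    (hleib : ∀ a b, δ₀ (a * b) = ψ a * δ₀ b + ψ b * δ₀ a) (Y : Finset R) :
    ∃ (m : ℕ) (Δ : Fin m → Derivation ℤ R R) (nn : Fin m → N),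
      ∀ y ∈ Y, δ₀ y = ∑ j, ψ (Δ j y) * nn j := by
  classical
  haveI : ExpChar k p := ExpChar.prime Fact.out
  set Φ' : MvPolynomial (Fin n) k →+* R := Φq.comp (algebraMap _ (Localization.AtPrime 𝔮))
    with hΦ'
  have hΦ'apply : ∀ F', Φ' F' = Φq (algebraMap _ _ F') := fun _ => rfl
  -- Jacobian data (with `d = 0`)
  obtain ⟨c, g, Dt, hg0, hspan, hDt⟩ := exists_jacobian_data k n 𝔮 Φq hsurj (d := 0) Fin.elim0
    (fun j => j.elim0) linearIndependent_empty_type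
  -- representatives `y · Φ'(den y) = Φ'(num y)`, `den y ∉ 𝔮`
  have hrep : ∀ y : R, ∃ (F s : MvPolynomial (Fin n) k), s ∈ 𝔮.primeCompl ∧ y * Φ' s = Φ' F := by
    intro y
    obtain ⟨z, rfl⟩ := hsurj y
    obtain ⟨⟨F, s⟩, rfl⟩ := IsLocalization.mk'_surjective 𝔮.primeCompl z
    refine ⟨F, s, s.2, ?_⟩
    dsimp only
    rw [hΦ'apply, hΦ'apply, ← map_mul, IsLocalization.mk'_spec]
  choose num den hden hnd using hrep
  -- the finitely many polynomials involved; a `p`-free set of constants for their coefficients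
  set 𝓕 : Finset (MvPolynomial (Fin n) k) := Y.image num ∪ Y.image den ∪ Finset.univ.image g
    with h𝓕
  have hnum : ∀ y ∈ Y, num y ∈ 𝓕 := fun y hy =>
    Finset.mem_union_left _ (Finset.mem_union_left _ (Finset.mem_image_of_mem _ hy))
  have hden𝓕 : ∀ y ∈ Y, den y ∈ 𝓕 := fun y hy =>
    Finset.mem_union_left _ (Finset.mem_union_right _ (Finset.mem_image_of_mem _ hy))
  have hg𝓕 : ∀ i, g i ∈ 𝓕 := fun i =>
    Finset.mem_union_right _ (Finset.mem_image_of_mem _ (Finset.mem_univ i))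
  set Cf : Finset k := 𝓕.biUnion fun F' => F'.coeffs with hCf
  obtain ⟨T, -, hTfree, hCfT⟩ := exists_isPFree_subset (p := p) Cf
  have hcoeffT : ∀ F' ∈ 𝓕, ∀ c ∈ F'.coeffs, c ∈ pAdjoin p (↑T : Set k) := fun F' hF' c hc =>
    hCfT (Finset.mem_coe.mpr (Finset.mem_biUnion.mpr ⟨F', hF', hc⟩))
  obtain ⟨dT, hdT⟩ := exists_dual_derivation hTfree
  -- partial derivatives `DX_i` and the extensions `DT_s` of the `∂_s`
  obtain ⟨DX, hDXC, hDXX⟩ : ∃ DX : Fin n → Derivation ℤ (MvPolynomial (Fin n) k)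
      (MvPolynomial (Fin n) k), (∀ i c, DX i (C c) = 0) ∧ ∀ i l, DX i (X l) = if l = i then 1 else 0 := by
    have h := fun i : Fin n => MvPolynomial.exists_derivation_C_eq_X_eq
      (T := MvPolynomial (Fin n) k) (0 : Derivation ℤ k (MvPolynomial (Fin n) k))
      fun l => if l = i then (1 : MvPolynomial (Fin n) k) else 0
    choose DX h1 h2 using h
    exact ⟨fun i => DX i, fun i c => (h1 i c).trans rfl, fun i l => h2 i l⟩
  obtain ⟨DT, hDTC, hDTX⟩ : ∃ DT : k → Derivation ℤ (MvPolynomial (Fin n) k)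
      (MvPolynomial (Fin n) k), (∀ s c, DT s (C c) = C (dT s c)) ∧ ∀ s l, DT s (X l) = 0 := by
    have h := fun s : k => MvPolynomial.exists_derivation_C_eq_X_eq
      (T := MvPolynomial (Fin n) k)
      ((Algebra.linearMap k (MvPolynomial (Fin n) k)).compDer (dT s))
      fun (_ : Fin n) => (0 : MvPolynomial (Fin n) k)
    choose DT h1 h2 using h
    exact ⟨fun s => DT s, fun s c => (h1 s c).trans rfl, fun s l => h2 s l⟩
  -- `∂P = δ₀ ∘ Φ'` as a derivation of `S` into the `S`-module `N`
  letI : Module (MvPolynomial (Fin n) k) N := Module.compHom N (ψ.comp Φ')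
  have hsmul : ∀ (a : MvPolynomial (Fin n) k) (x : N), a • x = ψ (Φ' a) * x := fun _ _ => rfl
  let f₀ : MvPolynomial (Fin n) k →+ N := δ₀.comp Φ'.toAddMonoidHom
  have hf₀ : ∀ F', f₀ F' = δ₀ (Φ' F') := fun _ => rfl
  have hf₀leib : ∀ a b, f₀ (a * b) = a • f₀ b + b • f₀ a := fun a b => by
    rw [hf₀, hf₀, hf₀, map_mul, hleib, hsmul, hsmul]
  obtain ⟨𝔇, h𝔇⟩ := exists_derivation_of_leibniz f₀ hf₀leib
  -- index type, generators, transported derivations, coefficients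
  let Γ := Fin n ⊕ (T : Set k)
  let Dg : Γ → Derivation ℤ (MvPolynomial (Fin n) k) (MvPolynomial (Fin n) k) :=
    Sum.elim DX fun s => DT s
  let gen : Γ → MvPolynomial (Fin n) k := Sum.elim X fun s => C (s : k)
  let nn : Γ → N := fun γ => δ₀ (Φ' (gen γ))
  -- expansion on `S` for the polynomials of `𝓕`
  have hexp : ∀ F' ∈ 𝓕, δ₀ (Φ' F') = ∑ γ : Γ, ψ (Φ' (Dg γ F')) * nn γ := by
    intro F' hF'
    have h := derivation_apply_eq_sum_of_coeffs k n p T dT hdT DX hDXC hDXX DT hDTC hDTX 𝔇 F'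
      (hcoeffT F' hF')
    rw [h𝔇, hf₀] at h
    rw [h, Fintype.sum_sum_type, ← Finset.sum_coe_sort T]
    simp only [hsmul, h𝔇, hf₀]
    rfl
  -- transport to `R`
  choose Δ hΔ using fun γ =>
    exists_derivation_transport k n 𝔮 Φq hsurj g Fin.elim0 Dt hspan hDt (Dg γ)
  set e : Fin c → MvPolynomial (Fin n) k → R := fun i F' =>
    Φq (Dt (Fin.castAdd 0 i) (algebraMap _ _ F')) with he
  have hΔ' : ∀ γ F', Φ' (Dg γ F') = Δ γ (Φ' F') + ∑ i, Φ' (Dg γ (g i)) * e i F' := by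
    intro γ F'
    have h := hΔ γ F'
    simp only [← hΦ'apply] at h
    rw [h, he]
    ring
  have hg0' : ∀ i, Φ' (g i) = 0 := fun i => hg0 i
  -- the correction terms cancel on `𝓕`
  have hkey : ∀ F' ∈ 𝓕, δ₀ (Φ' F') = ∑ γ : Γ, ψ (Δ γ (Φ' F')) * nn γ := by
    intro F' hF'
    rw [hexp F' hF']
    have h1 : ∑ γ : Γ, ψ (Φ' (Dg γ F')) * nn γ =
        ∑ γ : Γ, ψ (Δ γ (Φ' F')) * nn γ +
          ∑ i, ψ (e i F') * ∑ γ : Γ, ψ (Φ' (Dg γ (g i))) * nn γ := by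
      calc ∑ γ : Γ, ψ (Φ' (Dg γ F')) * nn γ
          = ∑ γ : Γ, (ψ (Δ γ (Φ' F')) * nn γ +
              ∑ i, ψ (e i F') * (ψ (Φ' (Dg γ (g i))) * nn γ)) := by
            refine Finset.sum_congr rfl fun γ _ => ?_
            rw [hΔ', map_add, map_sum, add_mul, Finset.sum_mul]
            congr 1
            exact Finset.sum_congr rfl fun i _ => by rw [map_mul]; ring
        _ = _ := by rw [Finset.sum_add_distrib, Finset.sum_comm]; simp only [Finset.mul_sum]
    rw [h1]
    have h2 : ∀ i, ∑ γ : Γ, ψ (Φ' (Dg γ (g i))) * nn γ = 0 := fun i => by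
      rw [← hexp (g i) (hg𝓕 i), hg0', map_zero]
    simp only [h2, mul_zero, Finset.sum_const_zero, add_zero]
  -- fractions: `ψ(Φ' den) · (∂ y - ∑ ψ(Δ_γ y) n_γ) = 0` and `ψ(Φ' den)` is a unit
  have hT : ∀ y ∈ Y, δ₀ y - ∑ γ : Γ, ψ (Δ γ y) * nn γ = 0 := by
    intro y hy
    have hu : IsUnit (ψ (Φ' (den y))) := by
      rw [hΦ'apply]
      exact ((IsLocalization.map_units (Localization.AtPrime 𝔮) ⟨den y, hden y⟩).map Φq).map ψ
    refine (hu.mul_right_eq_zero).mp ?_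
    have e1 : δ₀ (y * Φ' (den y)) = ψ y * δ₀ (Φ' (den y)) + ψ (Φ' (den y)) * δ₀ y := hleib _ _
    have e2 : ∀ γ, Δ γ (y * Φ' (den y)) = y * Δ γ (Φ' (den y)) + Φ' (den y) * Δ γ y :=
      fun γ => by rw [Derivation.leibniz, smul_eq_mul, smul_eq_mul]
    rw [hnd y] at e1 e2
    rw [hkey _ (hnum y hy), hkey _ (hden𝓕 y hy)] at e1
    simp only [e2, map_add, map_mul] at e1
    have e3 : ∑ γ : Γ, (ψ y * ψ (Δ γ (Φ' (den y))) + ψ (Φ' (den y)) * ψ (Δ γ y)) * nn γ =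
        ψ y * ∑ γ : Γ, ψ (Δ γ (Φ' (den y))) * nn γ +
          ψ (Φ' (den y)) * ∑ γ : Γ, ψ (Δ γ y) * nn γ := by
      rw [Finset.mul_sum, Finset.mul_sum, ← Finset.sum_add_distrib]
      exact Finset.sum_congr rfl fun γ _ => by ring
    linear_combination e3 - e1
  -- reindex by `Fin m`
  let eq := Fintype.equivFin Γ
  refine ⟨Fintype.card Γ, fun j => Δ (eq.symm j), fun j => nn (eq.symm j), fun y hy => ?_⟩
  rw [Equiv.sum_comp eq.symm (fun γ => ψ (Δ γ y) * nn γ)]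
  exact (sub_eq_zero.mp (hT y hy))

end Rich

/-- **Registered sub-goal `pthPowerModMonomial_richness`** (closed form of
`exists_derivations_sum_eq` in universe `0`, for `--supports` registration): every
`ψ`-derivation of `R` is, on finitely many elements, a combination of `ℤ`-derivations of `R`.
[folklore] -/
theorem pthPowerModMonomial_richness : ∀ (k : Type) [Field k] (n : ℕ) {R : Type} [CommRing R] [Algebra ℤ R] [IsRegularLocalRing R] (𝔮 : Ideal (MvPolynomial (Fin n) k)) [𝔮.IsPrime] (Φq : Localization.AtPrime 𝔮 →+* R), Function.Surjective Φq → ∀ (p : ℕ) [Fact p.Prime] [CharP k p] (N : Type) [CommRing N] (ψ : R →+* N) (δ₀ : R →+ N), (∀ a b, δ₀ (a * b) = ψ a * δ₀ b + ψ b * δ₀ a) → ∀ Y : Finset R, ∃ (m : ℕ) (Δ : Fin m → Derivation ℤ R R) (nn : Fin m → N), ∀ y ∈ Y, δ₀ y = Finset.univ.sum fun j => ψ (Δ j y) * nn j :=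
  fun k _ n _ _ _ _ 𝔮 _ Φq hsurj p _ _ N _ ψ δ₀ hleib Y =>
    exists_derivations_sum_eq k n 𝔮 Φq hsurj p N ψ δ₀ hleib Y

end Summit.ResolutionOfSingularities.ResolutionOfSingularities.Theorems.PfaffLine
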